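import Summits.BirchSwinnertonDyer.BirchSwinnertonDyer.Theses.LeadingTerm
import Summits.BirchSwinnertonDyer.BirchSwinnertonDyer.Theorems.PAdicOrderV2PAdicOrderComparisonR2StubTwoLeOrder
import Literature.NumberTheory.EllipticCurves.RegulatorProofs

/-!
# Crux `LeadingTerm.Consistency` (stmt-BirchSwinnertonDyer-16217) — crux-ideate round 1, ideator 2: Sketch

First lemmas of the two idea cards `fault-line-cut` and `wedge-avatar-pair`.

* `ConsistencyAt` — the crux body at one datum `(W, p, D, f)`; `consistency_iff` ties it to the route decl.
* FAULT-LINE CUT (card A): `Domination` (p-adic order dominates complex order, the LB half of the sibling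
  crux PAdicOrderComparisonR2 restricted to good ordinary `p ≥ 5`), `DiagonalPAB` (the p-adic Beilinson
  identity on the diagonal `r_MW = r_an`), `WellDefined` (positivity decoration, PROVED: `wellDefined_holds`);
  the glue `consistency_of_cut : SqueezeUBR2 → Domination → DiagonalPAB → Consistency` is PROVED, and so is
  `deficientVanishing_of_domination` (what `closes` actually consumes). Hypothesis-free partial domination from
  LANDED tree theorems: `one_le_order_of_one_le_analyticRank`, `two_le_order_of_two_le_even_analyticRank`;
  the odd step `DominationOddThree` (r_an odd ≥ 3 ⇒ 3 ≤ ord) is stated (provable relative to GZ86/PR87/FH95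
  facts: sibling crux 0489 idea heegner-torsion-squeeze), `DominationFour` is the first open instance.
* WEDGE AVATAR (card P): `WedgeAvatarPairAt` and the rank-one-proportionality glue `consistencyAt_of_wedge`.
-/

set_option linter.dupNamespace false

open scoped Classical

namespace Summit.BirchSwinnertonDyer.BirchSwinnertonDyer.Cruxes.Consistency.Sketch

open Summit.BirchSwinnertonDyer.BirchSwinnertonDyer.Theses.LeadingTerm
open Summit.BirchSwinnertonDyer.BirchSwinnertonDyer.Theorems
open Literature Literature.NumberTheory.EllipticCurves Literature.NumberTheory.EllipticCurves.ModularForms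

/-- The `p`-adic `L`-function `L_p(E,T)` of the route, as a power series over `ℚ_p`. -/
noncomputable abbrev Lp (W : WeierstrassCurve ℚ) [W.IsGloballyMinimal] (p : ℕ) [Fact p.Prime] {N : ℕ}
    (f : CuspForm (CongruenceSubgroup.Gamma0 N) 2) : PowerSeries ℚ_[p] :=
  padicLFunction f (unitRoot W p : ℚ_[p])

/-- The crux body at one datum: `ConsistencyAt W p D f`. -/
def ConsistencyAt (W : WeierstrassCurve ℚ) [W.IsElliptic] [W.IsGloballyMinimal] (p : ℕ) [Fact p.Prime]
    (D : WeierstrassCurve.PAdicHeightData W p) {N : ℕ} (f : CuspForm (CongruenceSubgroup.Gamma0 N) 2) : Prop :=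
  0 < W.regulator ∧ 0 < plusPeriod f ∧ ∃ q : ℚ,
    iteratedDeriv W.mordellWeilRank W.entireLFunction 1 =
      (((W.mordellWeilRank.factorial : ℝ) * (q : ℝ) * plusPeriod f * W.regulator : ℝ) : ℂ) ∧
    PowerSeries.coeff W.mordellWeilRank (Lp W p f) * padicLog p (cyclotomicGenerator p) ^ W.mordellWeilRank =
      (q : ℚ_[p]) * (1 - (unitRoot W p : ℚ_[p])⁻¹) ^ 2 * WeierstrassCurve.padicRegulator D

/-- The route decl is the ∀-closure of `ConsistencyAt` (definitional). -/
theorem consistency_iff :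
    Consistency ↔ ∀ (W : WeierstrassCurve ℚ) [W.IsElliptic] [W.IsGloballyMinimal] (p : ℕ) [Fact p.Prime],
      5 ≤ p → IsOrdinaryAt W p → ∀ (D : WeierstrassCurve.PAdicHeightData W p), D.IsCanonical →
      ∀ ⦃N : ℕ⦄ [NeZero N] (f : CuspForm (CongruenceSubgroup.Gamma0 N) 2), IsNewformOf W f →
        ConsistencyAt W p D f :=
  Iff.rfl

/-! ## Card A — the fault-line cut -/

/-- **Domination** (`p`-adic order dominates complex order): `ord_{s=1} L(E,s) ≤ ord_{T=0} L_p(E,T)` at every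
good ordinary `p ≥ 5` — the lower-bound half of the sibling crux `PAdicOrderComparisonR2` (stmt-0489),
restricted to the primes this crux quantifies over. Known for `r_an ≤ 3` and for the parity step (below). -/
def Domination : Prop :=
  ∀ (W : WeierstrassCurve ℚ) [W.IsElliptic] [W.IsGloballyMinimal] (p : ℕ) [Fact p.Prime],
    5 ≤ p → IsOrdinaryAt W p →
    ∀ ⦃N : ℕ⦄ [NeZero N] (f : CuspForm (CongruenceSubgroup.Gamma0 N) 2), IsNewformOf W f →
      (W.analyticRank : ℕ∞) ≤ (Lp W p f).order

/-- **Diagonal p-adic Beilinson identity**: the crux on the diagonal `r_MW = r_an` only (rank 0: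
Mazur–Swinnerton-Dyer interpolation; rank 1: Perrin-Riou 1987 with the constant; rank ≥ 2: the
`p`-adic Beilinson formula, BKS arXiv:1910.07404 Cor. 1.10, open). -/
def DiagonalPAB : Prop :=
  ∀ (W : WeierstrassCurve ℚ) [W.IsElliptic] [W.IsGloballyMinimal] (p : ℕ) [Fact p.Prime],
    5 ≤ p → IsOrdinaryAt W p → ∀ (D : WeierstrassCurve.PAdicHeightData W p), D.IsCanonical →
    ∀ ⦃N : ℕ⦄ [NeZero N] (f : CuspForm (CongruenceSubgroup.Gamma0 N) 2), IsNewformOf W f →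
      W.mordellWeilRank = W.analyticRank → ConsistencyAt W p D f

/-- The positivity decoration of the crux (`Reg_∞ > 0`, `Ω⁺_f > 0`). PROVED below. -/
def WellDefined : Prop :=
  ∀ (W : WeierstrassCurve ℚ) [W.IsElliptic] {N : ℕ} [NeZero N] (f : CuspForm (CongruenceSubgroup.Gamma0 N) 2),
    IsNewformOf W f → 0 < W.regulator ∧ 0 < plusPeriod f

theorem wellDefined_holds : WellDefined := by
  intro W _ N _ f hf
  exact ⟨WeierstrassCurve.regulator_pos_holds (W := W),
    IsNewform0.plusPeriod_pos_holds hf.1 hf.coeffField_eq_bot⟩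

/-- **What `closes` actually consumes**: in a deficient cell the Mordell–Weil-indexed coefficient of
`L_p` vanishes. -/
def DeficientVanishing : Prop :=
  ∀ (W : WeierstrassCurve ℚ) [W.IsElliptic] [W.IsGloballyMinimal] (p : ℕ) [Fact p.Prime],
    5 ≤ p → IsOrdinaryAt W p →
    ∀ ⦃N : ℕ⦄ [NeZero N] (f : CuspForm (CongruenceSubgroup.Gamma0 N) 2), IsNewformOf W f →
      W.mordellWeilRank < W.analyticRank → PowerSeries.coeff W.mordellWeilRank (Lp W p f) = 0

theorem deficientVanishing_of_domination (hDom : Domination) : DeficientVanishing := by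
  intro W _ _ p _ h5 hord N _ f hf hlt
  have hle := hDom W p h5 hord f hf
  exact PowerSeries.coeff_of_lt_order _ (lt_of_lt_of_le (by exact_mod_cast hlt) hle)

/-- Taylor coefficients of `L(E,s)` at `s = 1` below the analytic rank vanish (junk-robust). -/
theorem iteratedDeriv_eq_zero_of_lt_analyticRank (W : WeierstrassCurve ℚ) {n : ℕ}
    (hn : n < W.analyticRank) : iteratedDeriv n W.entireLFunction 1 = 0 := by
  have hpos : W.analyticRank ≠ 0 := by omega
  have han : AnalyticAt ℂ W.entireLFunction 1 := by
    by_contra h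
    exact hpos (by unfold WeierstrassCurve.analyticRank; exact analyticOrderNatAt_of_not_analyticAt h)
  have htop : analyticOrderAt W.entireLFunction 1 ≠ ⊤ := by
    intro h
    apply hpos
    unfold WeierstrassCurve.analyticRank analyticOrderNatAt
    rw [h]; rfl
  have hcast : ((W.analyticRank : ℕ) : ℕ∞) = analyticOrderAt W.entireLFunction 1 := by
    unfold WeierstrassCurve.analyticRank
    exact Nat.cast_analyticOrderNatAt htop
  exact (natCast_le_analyticOrderAt_iff_iteratedDeriv_eq_zero han).mp hcast.le n hn

/-- A deficient cell of the crux follows from the vanishing of ONE coefficient (with `q = 0`). -/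
theorem consistencyAt_of_deficient (W : WeierstrassCurve ℚ) [W.IsElliptic] [W.IsGloballyMinimal] (p : ℕ) [Fact p.Prime]
    (D : WeierstrassCurve.PAdicHeightData W p) {N : ℕ} [NeZero N] (f : CuspForm (CongruenceSubgroup.Gamma0 N) 2)
    (hf : IsNewformOf W f) (hlt : W.mordellWeilRank < W.analyticRank)
    (hcoeff : PowerSeries.coeff W.mordellWeilRank (Lp W p f) = 0) : ConsistencyAt W p D f := by
  obtain ⟨hreg, hΩ⟩ := wellDefined_holds W f hf
  refine ⟨hreg, hΩ, 0, ?_, ?_⟩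
  · rw [iteratedDeriv_eq_zero_of_lt_analyticRank W hlt]
    push_cast
    ring
  · rw [hcoeff]
    push_cast
    ring

/-- **The fault-line cut** (card A's glue, PROVED): excess cells are emptied by `SqueezeUBR2` (the route's
own crux #4), deficient cells follow from `Domination`, the diagonal is `DiagonalPAB`. -/
theorem consistency_of_cut (hUB : SqueezeUBR2) (hDom : Domination) (hDiag : DiagonalPAB) : Consistency := by
  intro W _ _ p _ h5 hord D hD N _ f hf
  rcases (hUB W).eq_or_lt with heq | hlt
  · exact hDiag W p h5 hord D hD f hf heq
  · exact consistencyAt_of_deficient W p D f hf hlt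
      (deficientVanishing_of_domination hDom W p h5 hord f hf hlt)

/-- Same cut with the weaker deficient input (what `closes` needs is exactly `DeficientVanishing`). -/
theorem consistency_of_cut' (hUB : SqueezeUBR2) (hDV : DeficientVanishing) (hDiag : DiagonalPAB) :
    Consistency := by
  intro W _ _ p _ h5 hord D hD N _ f hf
  rcases (hUB W).eq_or_lt with heq | hlt
  · exact hDiag W p h5 hord D hD f hf heq
  · exact consistencyAt_of_deficient W p D f hf hlt (hDV W p h5 hord f hf hlt)

/-! ### What the ROUTE actually needs: `DeficientVanishing`, not the leading-term identity

Kernel-checked form of the structural finding: the deciding theorem of route LeadingTerm goes through with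
`DeficientVanishing` (one vanishing coefficient in deficient cells) in place of the crux `Consistency`.
Transport block (T1)–(T3) copied from the route's certified `closes`. -/

theorem bsd_of_deficientVanishing (hDV : DeficientVanishing) (hP : PinchPrime) (hUB : SqueezeUBR2) :
    _root_.BirchSwinnertonDyer := by
  -- (T1) the Mordell–Weil rank is an isomorphism invariant
  have hMW : ∀ (W : WeierstrassCurve ℚ) (C : WeierstrassCurve.VariableChange ℚ),
      (C • W).mordellWeilRank = W.mordellWeilRank := fun W C =>
    @WeierstrassCurve.VariableChange.finrank_point_variableChange ℚ _ W C (Classical.decEq ℚ)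
  -- (T2) the local Euler factor over the fraction field of a DVR is an isomorphism invariant
  have hloc : ∀ (R : Type) [CommRing R] [IsDomain R] [IsDiscreteValuationRing R]
      (K : Type) [Field K] [Algebra R K] [IsFractionRing R K]
      (W : WeierstrassCurve K) [W.IsElliptic] (C : WeierstrassCurve.VariableChange K),
      (C • W).localEulerFactor R = W.localEulerFactor R := by
    intro R _ _ _ K _ _ _ W _ C
    obtain ⟨D, hD⟩ : ∃ D : WeierstrassCurve.VariableChange K,
        (C • W).minimal R = D • W.minimal R :=
      ⟨((C • W).exists_isMinimal R).choose * C * ((W.exists_isMinimal R).choose)⁻¹, by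
        rw [WeierstrassCurve.minimal, WeierstrassCurve.minimal, mul_smul, mul_smul, inv_smul_smul]⟩
    haveI hE : (W.minimal R).IsElliptic := by rw [WeierstrassCurve.minimal]; infer_instance
    have hΔ : (W.minimal R).Δ ≠ 0 := (W.minimal R).isUnit_Δ.ne_zero
    have hgood : ((C • W).minimal R).HasGoodReduction R ↔ (W.minimal R).HasGoodReduction R := by
      rw [WeierstrassCurve.hasGoodReduction_iff, WeierstrassCurve.hasGoodReduction_iff,
        WeierstrassCurve.valuation_Δ_eq_of_isMinimal_of_eq_smul R hD]
      exact and_congr_left' ⟨fun _ => inferInstance, fun _ => inferInstance⟩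
    have hcard : Nat.card (((C • W).minimal R).reduction R).toAffine.Point =
        Nat.card ((W.minimal R).reduction R).toAffine.Point := by
      obtain ⟨E, hE⟩ := WeierstrassCurve.exists_reduction_eq_smul R hD hΔ
      rw [hE]
      exact WeierstrassCurve.natCard_point_smul _ _
    have hpoly : (C • W).localPolynomial R = W.localPolynomial R := by
      classical
      unfold WeierstrassCurve.localPolynomial
      simp only [hgood, hcard,
        WeierstrassCurve.hasSplitMultiplicativeReduction_iff_of_isMinimal_of_eq_smul R hD hΔ,
        WeierstrassCurve.hasMultiplicativeReduction_iff_of_isMinimal_of_eq_smul R hD hΔ]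
    simp only [WeierstrassCurve.localEulerFactor, WeierstrassCurve.localPowerSeries, hpoly]
  -- (T3) hence the entire L-function and the analytic rank are isomorphism invariants
  have hEL : ∀ (W : WeierstrassCurve ℚ) [W.IsElliptic] (C : WeierstrassCurve.VariableChange ℚ),
      (C • W).entireLFunction = W.entireLFunction := by
    intro W _ C
    have hL : (C • W).LFunction = W.LFunction := by
      unfold WeierstrassCurve.LFunction
      congr 1
      funext v
      simp only [WeierstrassCurve.baseChange, ← WeierstrassCurve.map_variableChange]
      exact hloc _ _ _ _
    have hLS : (C • W).LSeries = W.LSeries := by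
      funext s
      simp only [WeierstrassCurve.LSeries, hL]
    have hEC : (C • W).entireContinuations = W.entireContinuations := by
      simp only [WeierstrassCurve.entireContinuations, hLS]
    unfold WeierstrassCurve.entireLFunction
    rw [hEC, hLS]
  -- main argument: UB, then a pinch prime on a global minimal model contradicts a deficient cell
  intro W hW
  haveI : W.IsElliptic := hW
  have hub : W.mordellWeilRank ≤ W.analyticRank := hUB W
  obtain ⟨C, hCmin⟩ := WeierstrassCurve.hasGlobalMinimalModel_rat_holds W
  haveI : (C • W).IsGloballyMinimal := hCmin
  obtain ⟨p, hp, h5, hord, D, -, N, hN, f, hf, horder⟩ := hP (C • W)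
  haveI : Fact p.Prime := hp
  haveI : NeZero N := hN
  have hAR : (C • W).analyticRank = W.analyticRank := by
    unfold WeierstrassCurve.analyticRank; rw [hEL W C]
  by_contra hne
  have hlt : (C • W).mordellWeilRank < (C • W).analyticRank := by
    rw [hMW W C, hAR]; omega
  have hcoeff : PowerSeries.coeff (C • W).mordellWeilRank (Lp (C • W) p f) ≠ 0 :=
    (PowerSeries.order_eq_nat.mp horder).1
  exact hcoeff (hDV (C • W) p h5 hord f hf hlt)

/-! ### Known domination, hypothesis-free from LANDED tree theorems -/

/-- `r_an ≥ 1 ⇒ ord_T L_p ≥ 1` (Mazur–Swinnerton-Dyer interpolation; landed `stub_constantCoeff_eq_zero_iff`). -/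
theorem one_le_order_of_one_le_analyticRank (W : WeierstrassCurve ℚ) [W.IsElliptic] [W.IsGloballyMinimal]
    (p : ℕ) [Fact p.Prime] (hord : IsOrdinaryAt W p) {N : ℕ} [NeZero N]
    (f : CuspForm (CongruenceSubgroup.Gamma0 N) 2) (hf : IsNewformOf W f) (h1 : 1 ≤ W.analyticRank) :
    (1 : ℕ∞) ≤ (Lp W p f).order := by
  have hc : PowerSeries.constantCoeff (Lp W p f) = 0 := (stub_constantCoeff_eq_zero_iff W p hord f hf).mpr h1
  refine PowerSeries.nat_le_order _ 1 fun i hi => ?_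
  obtain rfl : i = 0 := by omega
  simpa only [PowerSeries.coeff_zero_eq_constantCoeff] using hc

/-- `r_an ≥ 2` even `⇒ ord_T L_p ≥ 2` (interpolation + same-sign parity; landed stubs). -/
theorem two_le_order_of_two_le_even_analyticRank (W : WeierstrassCurve ℚ) [W.IsElliptic] [W.IsGloballyMinimal]
    (p : ℕ) [Fact p.Prime] (hord : IsOrdinaryAt W p) {N : ℕ} [NeZero N]
    (f : CuspForm (CongruenceSubgroup.Gamma0 N) 2) (hf : IsNewformOf W f)
    (h2 : 2 ≤ W.analyticRank) (heven : Even W.analyticRank) :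
    (2 : ℕ∞) ≤ (Lp W p f).order := by
  have h1 := one_le_order_of_one_le_analyticRank W p hord f hf (by omega)
  have hpar := stub_even_order_iff_even_analyticRank W p hord f hf
  by_contra hlt
  push Not at hlt
  have hfin : (Lp W p f).order ≠ ⊤ := by intro htop; rw [htop] at hlt; exact absurd hlt (by simp)
  have hnat : ((Lp W p f).order.toNat : ℕ∞) = (Lp W p f).order := ENat.coe_toNat hfin
  have hone : (Lp W p f).order.toNat = 1 := by
    have hle : (1 : ℕ∞) ≤ ((Lp W p f).order.toNat : ℕ∞) := by rwa [hnat]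
    have hlt' : ((Lp W p f).order.toNat : ℕ∞) < 2 := by rwa [hnat]
    have := ENat.coe_le_coe.mp (show ((1 : ℕ) : ℕ∞) ≤ _ from hle)
    have := ENat.coe_lt_coe.mp (show ((Lp W p f).order.toNat : ℕ∞) < ((2 : ℕ) : ℕ∞) from hlt')
    omega
  have h := hpar.mpr heven
  rw [hone] at h
  exact absurd h (by decide)

/-- Hence the deficient cells with `r_MW = 0`, and with `r_MW = 1`, `r_an` even, hold NOW. -/
theorem deficientVanishing_rank_zero (W : WeierstrassCurve ℚ) [W.IsElliptic] [W.IsGloballyMinimal]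
    (p : ℕ) [Fact p.Prime] (hord : IsOrdinaryAt W p) {N : ℕ} [NeZero N]
    (f : CuspForm (CongruenceSubgroup.Gamma0 N) 2) (hf : IsNewformOf W f)
    (h0 : W.mordellWeilRank = 0) (hlt : W.mordellWeilRank < W.analyticRank) :
    PowerSeries.coeff W.mordellWeilRank (Lp W p f) = 0 := by
  have h1 := one_le_order_of_one_le_analyticRank W p hord f hf (by omega)
  rw [h0]
  exact PowerSeries.coeff_of_lt_order 0 (lt_of_lt_of_le (by exact_mod_cast Nat.zero_lt_one) h1)

theorem deficientVanishing_rank_one_even (W : WeierstrassCurve ℚ) [W.IsElliptic] [W.IsGloballyMinimal]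
    (p : ℕ) [Fact p.Prime] (hord : IsOrdinaryAt W p) {N : ℕ} [NeZero N]
    (f : CuspForm (CongruenceSubgroup.Gamma0 N) 2) (hf : IsNewformOf W f)
    (h1 : W.mordellWeilRank = 1) (hlt : W.mordellWeilRank < W.analyticRank) (heven : Even W.analyticRank) :
    PowerSeries.coeff W.mordellWeilRank (Lp W p f) = 0 := by
  have h2 := two_le_order_of_two_le_even_analyticRank W p hord f hf (by omega) heven
  rw [h1]
  exact PowerSeries.coeff_of_lt_order 1 (lt_of_lt_of_le (by exact_mod_cast Nat.one_lt_two) h2)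

/-- **The odd step** (target; provable relative to the tree facts `gross_zagier`-type `analyticRankEK_eq_add`,
`analyticRankEK_eq_one_iff_heegner_nonTorsion`, `perrinRiou_padicGrossZagier` read at a TORSION Heegner point,
`friedbergHoffstein_exists_heegnerField_split_twist_ne_zero`, interpolation for the twist — the torsion transfer
of the sibling crux 0489): `r_an` odd `≥ 3 ⇒ 3 ≤ ord_T L_p`. -/
def DominationOddThree : Prop :=
  ∀ (W : WeierstrassCurve ℚ) [W.IsElliptic] [W.IsGloballyMinimal] (p : ℕ) [Fact p.Prime],
    5 ≤ p → IsOrdinaryAt W p →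
    ∀ ⦃N : ℕ⦄ [NeZero N] (f : CuspForm (CongruenceSubgroup.Gamma0 N) 2), IsNewformOf W f →
      3 ≤ W.analyticRank → Odd W.analyticRank → (3 : ℕ∞) ≤ (Lp W p f).order

/-- **First open instance of domination** (cell `(r_MW, r_an) = (2,4)` of the crux; card A's residual for the
ROUTE): `r_an ≥ 4 ⇒ [T²] L_p = [T³] L_p = 0`, i.e. `4 ≤ ord_T L_p` (parity makes `≥ 3` and `≥ 4` equivalent
for even `r_an`). No known mechanism: the Heegner point is torsion in all these ranks alike. -/
def DominationFour : Prop :=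
  ∀ (W : WeierstrassCurve ℚ) [W.IsElliptic] [W.IsGloballyMinimal] (p : ℕ) [Fact p.Prime],
    5 ≤ p → IsOrdinaryAt W p →
    ∀ ⦃N : ℕ⦄ [NeZero N] (f : CuspForm (CongruenceSubgroup.Gamma0 N) 2), IsNewformOf W f →
      4 ≤ W.analyticRank → (4 : ℕ∞) ≤ (Lp W p f).order

/-- With the odd step, every deficient cell with `r_MW ≤ 1`, and the cells `(2, odd)`, hold. -/
theorem deficientVanishing_rank_le_two_of_oddThree (hodd : DominationOddThree)
    (W : WeierstrassCurve ℚ) [W.IsElliptic] [W.IsGloballyMinimal]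
    (p : ℕ) [Fact p.Prime] (h5 : 5 ≤ p) (hord : IsOrdinaryAt W p) {N : ℕ} [NeZero N]
    (f : CuspForm (CongruenceSubgroup.Gamma0 N) 2) (hf : IsNewformOf W f)
    (hlt : W.mordellWeilRank < W.analyticRank)
    (hcell : W.mordellWeilRank ≤ 1 ∨ (W.mordellWeilRank = 2 ∧ Odd W.analyticRank)) :
    PowerSeries.coeff W.mordellWeilRank (Lp W p f) = 0 := by
  apply PowerSeries.coeff_of_lt_order
  rcases Nat.even_or_odd W.analyticRank with heven | hoddr
  · -- r_an even (≥ 2): ord ≥ 2 > r_MW ≤ 1; the cell (2, even) is excluded by `hcell`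
    have hMW : W.mordellWeilRank ≤ 1 := by
      rcases hcell with h | ⟨-, h⟩
      · exact h
      · exact absurd heven (Nat.not_even_iff_odd.mpr h)
    have h2 := two_le_order_of_two_le_even_analyticRank W p hord f hf (by
      rcases heven with ⟨k, hk⟩; omega) heven
    exact lt_of_lt_of_le (by exact_mod_cast (show W.mordellWeilRank < 2 by omega)) h2
  · -- r_an odd
    rcases Nat.lt_or_ge W.analyticRank 3 with hsmall | h3
    · -- r_an = 1: r_MW = 0
      have h1 := one_le_order_of_one_le_analyticRank W p hord f hf (by omega)
      have : W.analyticRank = 1 := by rcases hoddr with ⟨k, hk⟩; omega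
      exact lt_of_lt_of_le (by exact_mod_cast (show W.mordellWeilRank < 1 by omega)) h1
    · have h3' := hodd W p h5 hord f hf h3 hoddr
      have hMW : W.mordellWeilRank < 3 := by rcases hcell with h | ⟨h, -⟩ <;> omega
      exact lt_of_lt_of_le (by exact_mod_cast hMW) h3'

/-! ## Card P — the wedge avatar pair -/

/-- **Wedge avatar pair at one datum**: both leading terms at the Mordell–Weil index are computed by ONE scalar
`t ∈ ℚ` (the coordinate of a conjectural avatar `η = t·(P₁∧…∧P_r)` on the RANK-ONE line `∧^r E(ℚ) ⊗ ℚ`) and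
ONE calibration constant `c ∈ ℚ` common to the two realisations:
`L^{(r)}(E,1) = r!·(c t²)·Ω⁺_f·Reg_∞` and `[T^r]L_p·log_p(γ)^r = (c t²)·(1-α⁻¹)²·Reg_p`. -/
def WedgeAvatarPairAt (W : WeierstrassCurve ℚ) [W.IsElliptic] [W.IsGloballyMinimal] (p : ℕ) [Fact p.Prime]
    (D : WeierstrassCurve.PAdicHeightData W p) {N : ℕ} (f : CuspForm (CongruenceSubgroup.Gamma0 N) 2)
    (c : ℚ) : Prop :=
  ∃ t : ℚ,
    iteratedDeriv W.mordellWeilRank W.entireLFunction 1 =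
      (((W.mordellWeilRank.factorial : ℝ) * ((c * t ^ 2 : ℚ) : ℝ) * plusPeriod f * W.regulator : ℝ) : ℂ) ∧
    PowerSeries.coeff W.mordellWeilRank (Lp W p f) * padicLog p (cyclotomicGenerator p) ^ W.mordellWeilRank =
      ((c * t ^ 2 : ℚ) : ℚ_[p]) * (1 - (unitRoot W p : ℚ_[p])⁻¹) ^ 2 * WeierstrassCurve.padicRegulator D

/-- Rank-one proportionality glue (card P, PROVED): an avatar pair at `(W,p,D,f)` gives the crux there with
`q = c·t²` — in EVERY cell (diagonal, deficient `t = 0`, excess alike). -/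
theorem consistencyAt_of_wedge (W : WeierstrassCurve ℚ) [W.IsElliptic] [W.IsGloballyMinimal] (p : ℕ) [Fact p.Prime]
    (D : WeierstrassCurve.PAdicHeightData W p) {N : ℕ} [NeZero N] (f : CuspForm (CongruenceSubgroup.Gamma0 N) 2)
    (hf : IsNewformOf W f) {c : ℚ} (h : WedgeAvatarPairAt W p D f c) : ConsistencyAt W p D f := by
  obtain ⟨hreg, hΩ⟩ := wellDefined_holds W f hf
  obtain ⟨t, harch, hpad⟩ := h
  exact ⟨hreg, hΩ, c * t ^ 2, harch, hpad⟩

/-- The square-class refinement the avatar mechanism predicts (a falsifiable STRENGTHENING of the diagonal: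
`q ∈ c·ℚ²` with `c = c(N, aux data)` the calibration constant read off the Artin-split configuration). -/
def WedgeAvatarPair (c : ∀ (W : WeierstrassCurve ℚ) (p : ℕ), ℚ) : Prop :=
  ∀ (W : WeierstrassCurve ℚ) [W.IsElliptic] [W.IsGloballyMinimal] (p : ℕ) [Fact p.Prime],
    5 ≤ p → IsOrdinaryAt W p → ∀ (D : WeierstrassCurve.PAdicHeightData W p), D.IsCanonical →
    ∀ ⦃N : ℕ⦄ [NeZero N] (f : CuspForm (CongruenceSubgroup.Gamma0 N) 2), IsNewformOf W f →
      WedgeAvatarPairAt W p D f (c W p)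

theorem consistency_of_wedgeAvatarPair {c : ∀ (W : WeierstrassCurve ℚ) (p : ℕ), ℚ}
    (h : WedgeAvatarPair c) : Consistency := by
  intro W _ _ p _ h5 hord D hD N _ f hf
  exact consistencyAt_of_wedge W p D f hf (h W p h5 hord D hD f hf)

end Summit.BirchSwinnertonDyer.BirchSwinnertonDyer.Cruxes.Consistency.Sketch
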